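import Literature.MathematicalPhysics.QuantumLattice.GaugeGroups
import Mathlib.Probability.Independence.Basic
import Mathlib.MeasureTheory.Integral.Prod
import HarnessLib

/-!
# Route `ToronCumulantSign`, crux `OneSiteCovDerivative` (stmt-QuantumFields-27531) — helper II:
# product-Haar bookkeeping — integrals of functions of two or four independent links are iterated Haar integrals

For a compact second-countable group `G` with its Haar probability measure `dg` and a finite index set `ι` of links, under the
product measure `π = ⊗_{e ∈ ι} dg` the links are independent and Haar distributed (Mathlib `iIndepFun_pi`,
`measurePreserving_eval`), so for distinct links `a ≠ b` the pair `(U_a, U_b)` has law `dg ⊗ dg` (`map_eval_pair`) and for four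
distinct links the pair of pairs `((U_a,U_b),(U_c,U_d))` has law `(dg ⊗ dg) ⊗ (dg ⊗ dg)` (`map_eval_quad`); consequently a
continuous function of two (resp. four) links integrates to the corresponding ITERATED Haar integral (`integral_eval_pair`,
`integral_eval_quad`).  This is the Fubini bookkeeping for the one-site (`L = 1`, Eguchi–Kawai) torus, whose four links carry
product Haar measure at `β = 0`.  HONEST LABEL: elementary measure theory; helper toward the OPEN crux `OneSiteCovDerivative`;
nothing about the Yang–Mills mass gap.

References: S. Chatterjee, arXiv:1803.01950 §2 (the lattice set-up); Mathlib `ProbabilityTheory.iIndepFun_pi`.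
-/

noncomputable section

open MeasureTheory ProbabilityTheory
open Literature.MathematicalPhysics.QuantumFieldTheory

namespace Summit.QuantumFields.YangMills.Theorems.ToronCumulantSign

section Fubini

variable {ι : Type*} [Fintype ι] {G : Type*} [Group G] [TopologicalSpace G] [IsTopologicalGroup G]
  [CompactSpace G] [MeasurableSpace G] [BorelSpace G] [SecondCountableTopology G]

/-- Local shorthand: product Haar measure on the links. -/
local notation3 (prettyPrint := false) "πH" => Measure.pi (fun _ : ι => haarProbability G)

omit [SecondCountableTopology G] in
/-- The links are independent under product Haar measure. [folklore] -/
theorem iIndepFun_eval : iIndepFun (fun (e : ι) (U : ι → G) => U e) πH :=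
  iIndepFun_pi (X := fun (_ : ι) (g : G) => g) (fun _ => aemeasurable_id)

omit [SecondCountableTopology G] in
/-- Each link is Haar distributed under product Haar measure. [folklore] -/
theorem map_eval (a : ι) : (πH).map (fun U : ι → G => U a) = haarProbability G :=
  (measurePreserving_eval (fun _ : ι => haarProbability G) a).map_eq

omit [SecondCountableTopology G] in
/-- **Two distinct links are independent Haar**: the law of `(U_a, U_b)` is `dg ⊗ dg`. [folklore] -/
theorem map_eval_pair {a b : ι} (hab : a ≠ b) :
    (πH).map (fun U : ι → G => (U a, U b)) = (haarProbability G).prod (haarProbability G) := by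
  have hind := (iIndepFun_eval (ι := ι) (G := G)).indepFun hab
  rw [(indepFun_iff_map_prod_eq_prod_map_map (measurable_pi_apply a).aemeasurable
    (measurable_pi_apply b).aemeasurable).mp hind, map_eval, map_eval]

omit [SecondCountableTopology G] in
/-- **Four distinct links**: the law of `((U_a, U_b), (U_c, U_d))` is `(dg ⊗ dg) ⊗ (dg ⊗ dg)`. [folklore] -/
theorem map_eval_quad {a b c d : ι} (hab : a ≠ b) (hcd : c ≠ d) (hac : a ≠ c) (had : a ≠ d) (hbc : b ≠ c) (hbd : b ≠ d) :
    (πH).map (fun U : ι → G => ((U a, U b), (U c, U d))) =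
      ((haarProbability G).prod (haarProbability G)).prod ((haarProbability G).prod (haarProbability G)) := by
  have hind := (iIndepFun_eval (ι := ι) (G := G)).indepFun_prodMk_prodMk (fun e => measurable_pi_apply e)
    a b c d hac had hbc hbd
  have hm1 : AEMeasurable (fun U : ι → G => (U a, U b)) πH :=
    ((measurable_pi_apply a).prodMk (measurable_pi_apply b)).aemeasurable
  have hm2 : AEMeasurable (fun U : ι → G => (U c, U d)) πH :=
    ((measurable_pi_apply c).prodMk (measurable_pi_apply d)).aemeasurable
  rw [(indepFun_iff_map_prod_eq_prod_map_map hm1 hm2).mp hind, map_eval_pair hab, map_eval_pair hcd]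

/-- ★ **Integral of a continuous function of two distinct links** = the iterated Haar integral. [folklore] -/
theorem integral_eval_pair {a b : ι} (hab : a ≠ b) (F : G × G → ℝ) (hF : Continuous F) :
    ∫ U, F (U a, U b) ∂πH = ∫ x, ∫ y, F (x, y) ∂haarProbability G ∂haarProbability G := by
  have hm : AEMeasurable (fun U : ι → G => (U a, U b)) πH :=
    ((measurable_pi_apply a).prodMk (measurable_pi_apply b)).aemeasurable
  have h1 : ∫ U, F (U a, U b) ∂πH = ∫ z, F z ∂((πH).map (fun U : ι → G => (U a, U b))) :=
    (integral_map hm hF.aestronglyMeasurable).symm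
  rw [h1, map_eval_pair hab, integral_prod]
  exact hF.integrable_of_hasCompactSupport (HasCompactSupport.of_compactSpace _)

/-- ★ **Integral of a continuous function of four distinct links** = the fourfold iterated Haar integral. [folklore] -/
theorem integral_eval_quad {a b c d : ι} (hab : a ≠ b) (hcd : c ≠ d) (hac : a ≠ c) (had : a ≠ d) (hbc : b ≠ c)
    (hbd : b ≠ d) (F : (G × G) × (G × G) → ℝ) (hF : Continuous F) :
    ∫ U, F ((U a, U b), (U c, U d)) ∂πH =
      ∫ x, ∫ x', ∫ y, ∫ y', F ((x, x'), (y, y')) ∂haarProbability G ∂haarProbability G ∂haarProbability G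
        ∂haarProbability G := by
  have hm : AEMeasurable (fun U : ι → G => ((U a, U b), (U c, U d))) πH :=
    (((measurable_pi_apply a).prodMk (measurable_pi_apply b)).prodMk
      ((measurable_pi_apply c).prodMk (measurable_pi_apply d))).aemeasurable
  have h1 : ∫ U, F ((U a, U b), (U c, U d)) ∂πH = ∫ z, F z ∂((πH).map (fun U : ι → G => ((U a, U b), (U c, U d)))) :=
    (integral_map hm hF.aestronglyMeasurable).symm
  have hFi : Integrable F (((haarProbability G).prod (haarProbability G)).prod
      ((haarProbability G).prod (haarProbability G))) :=
    hF.integrable_of_hasCompactSupport (HasCompactSupport.of_compactSpace _)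
  rw [h1, map_eval_quad hab hcd hac had hbc hbd, integral_prod _ hFi]
  -- split the outer pair
  have hinner : ∀ p : G × G, Continuous fun q : G × G => F (p, q) := fun p => hF.comp (Continuous.prodMk_right p)
  rw [integral_prod _ hFi.integral_prod_left]
  refine integral_congr_ae (ae_of_all _ fun x => integral_congr_ae (ae_of_all _ fun x' => ?_))
  simp only
  rw [integral_prod _ ((hinner (x, x')).integrable_of_hasCompactSupport (HasCompactSupport.of_compactSpace _))]

end Fubini

end Summit.QuantumFields.YangMills.Theorems.ToronCumulantSign
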